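import Summits.BirchSwinnertonDyer.BirchSwinnertonDyer.Theorems.CyclotomicUntwistNineIntegersResidueMap
import Summits.BirchSwinnertonDyer.BirchSwinnertonDyer.Theorems.CyclotomicUntwistGNineSpecialFibre
import Summits.BirchSwinnertonDyer.BirchSwinnertonDyer.Theorems.CyclotomicUntwistGNineSpecialFibreTrace
import Summits.BirchSwinnertonDyer.BirchSwinnertonDyer.Theorems.CyclotomicUntwistGNineLeafFrobeniusTrace
import HarnessLib

/-!
# The leaf-II family has an EXPLICIT good model over `𝓞 = integralClosure ℤ₃ ℚ₃(ζ₉)` (a `NineGoodModel` of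
# `Literature.DescendedFrobeniusMatrix`) with special fibre `y² = x³ − x + γ̄₁` along EVERY reduction map,
# hence `specialFibreTrace = psUntwistedTrace` — the local half of stub S2 of line `dfrob`, leaf II

Cell `pub/bsd-wall` (D-0145 line `route-BirchSwinnertonDyer-CyclotomicUntwist`), seat `bsd-line-cycu-p4` (gen 7),
helper toward K1 `PSRankOneLowerHalfAtThree` (stmt-BirchSwinnertonDyer-21580) / K2 (21581), registered line `dfrob`
(lead cycu-p1 g5), stub **S2 `stub_descendedFrobenius`** (`∃ M, IsDescendedFrobeniusMatrix W M ∧ tr M = a_w(W) ∧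
M₁₀ ≠ 0` on the principal-series rows). THEOREMS ONLY (no definition, no named fact, no `sorry`); BSD is not proved
by this file and no crux is.

## What

For the Kodaira-II principal-series family `V = ⟨0, 3 · (3 · α₁ - g), 0, 9 · β, 3 · (3 · γ₁ + g)⟩` over `ℚ`
(`g = ±1`, `v₃Δ = 4`; every principal-series curve with `v₃Δ_min = 4` reaches such a `V` from its minimal
model by a `ℚ`-isomorphism, and the `IV*`/`II*` rows after the `√−3`-rescaling — cycu-p1's `GNineLeaves`, the route's
`GNineCriterion`), the change of variables `u = ϖ²`, `r = gϖ²(1 + ϖ)` (`ϖ = 1 − ζ₉`) over `K = ℚ₃(ζ₉)` carries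
`V ⊗ K` to a Weierstrass equation `E` whose coefficients `y₂·θ⁻1, y₄·θ⁻2, y₆·θ⁻2` lie in `ℤ[ζ₉] ⊆ 𝓞`:
the `yᵢ ∈ ℤ[ϖ]` are the integrality certificates `GNineSpecialFibre.leafII_aᵢ_identity` (cycu-p3, from cycu-p1's
cofactors) and `θ⁻¹ ∈ ℤ[ζ₉]` is `NineIntegers.theta_mul_thetaInv`; its discriminant is `θ⁻4·Δᵘ` with `3 ∤ Δᵘ`, a unit
of `𝓞`. So:

* `leafII_smul_eq` (any field with a primitive ninth root of unity) — the change of variables lands on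
  `⟨0, y₂θ⁻1, 0, y₄θ⁻2, y₆θ⁻2⟩`; `leafII_pow_identity` — `u⁻¹²·3^4 = θ⁻4`;
* `exists_nineGoodModel_leafII` — **`∃ 𝓜 : V.NineGoodModel, ∀ ρ : 𝓞 →+* ZMod 3, 𝓜.specialFibre ρ = ⟨0, 0, 0, −1, γ̄₁⟩`**
  (every `ρ` kills `1 − ζ₉` and fixes `θ⁻¹`: `NineIntegersResidueMap`);
* `exists_nineGoodModel_trace_leafII` — **`∃ 𝓜, ∀ ρ, 3 ∣ 𝓜.specialFibreTrace ρ ∧ 𝓜.specialFibreTrace ρ =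
  V.psUntwistedTrace`** (with cycu-p1's point count and cycu-p3's `psUntwistedTrace_leafII_eq_trace`): exactly the
  hypothesis / output that `isDescendedFrobeniusMatrix_exists` and `IsDescendedFrobeniusMatrix.trace_eq` need on this family.

References: J. Tate, LNM 476 (1975) §7 [Tate1975]; A. Kraus, Manuscripta Math. 69 (1990), Théorème 1 (p = 3)
[Kraus1990]; J. H. Silverman, *AEC* VII.1 [SilvermanAEC2009]; N. M. Katz, LNM 868 (1981) §5 [Katz1981CrystallineDieudonne].
-/

noncomputable section

open scoped Polynomial

open Polynomial IsCyclotomicExtension WeierstrassCurve Literature.NumberTheory.EllipticCurves.DescendedFrobenius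
  Summit.BirchSwinnertonDyer.BirchSwinnertonDyer.Theorems

-- single-conjunct summit: `Summit.BirchSwinnertonDyer.BirchSwinnertonDyer.…` repeats the name by design
set_option linter.dupNamespace false
-- one uniform `simp only` set reads every coefficient of the model and of its special fibre
set_option linter.unusedSimpArgs false
set_option autoImplicit false

namespace Summit.BirchSwinnertonDyer.BirchSwinnertonDyer.Theorems.NineGoodModels

/-! ### Two generic tools -/

/-- **Descending a certified coefficient**: from the integrality certificate `X·θᵏ = uᵐ·y` (with `θ·θ⁻¹ = 1`,
`u ≠ 0`) the transformed coefficient is `u⁻ᵐ·X = y·θ⁻ᵏ`. [folklore] -/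
theorem descend_coeff {K : Type*} [Field K] {X θ θi u y : K} {k m : ℕ} (hθ : θ * θi = 1) (hu : u ≠ 0)
    (h : X * θ ^ k = u ^ m * y) : u⁻¹ ^ m * X = y * θi ^ k := by
  calc u⁻¹ ^ m * X = u⁻¹ ^ m * X * (θ * θi) ^ k := by rw [hθ, one_pow, mul_one]
    _ = u⁻¹ ^ m * (X * θ ^ k) * θi ^ k := by ring
    _ = u⁻¹ ^ m * (u ^ m * y) * θi ^ k := by rw [h]
    _ = y * θi ^ k := by rw [← mul_assoc, ← mul_pow, inv_mul_cancel₀ hu, one_pow, one_mul]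

/-- **Reading the trace off the special fibre `y² = x³ − x + b`.** For ANY `W/ℚ`, a good model `𝓜` over `𝓞` and a
reduction map `ρ` with `𝓜.specialFibre ρ = ⟨0, 0, 0, −1, b⟩`: `𝓜.specialFibreTrace ρ = −3·valMinAbs b`, so
`3 ∣ 𝓜.specialFibreTrace ρ` and `|𝓜.specialFibreTrace ρ| ≤ 3` (cycu-p1's point count of the three supersingular
curves over `𝔽₃`). [cite: SilvermanAEC2009, V.2] -/
theorem specialFibreTrace_eq_of_specialFibre_eq {W : WeierstrassCurve ℚ} (𝓜 : W.NineGoodModel)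
    (ρ : ONine →+* ZMod 3) (b : ZMod 3) (h : 𝓜.specialFibre ρ = ⟨0, 0, 0, -1, b⟩) :
    𝓜.specialFibreTrace ρ = -3 * ZMod.valMinAbs b ∧ (3 : ℤ) ∣ 𝓜.specialFibreTrace ρ ∧
      (𝓜.specialFibreTrace ρ).natAbs ≤ 3 := by
  have e : 𝓜.specialFibreTrace ρ =
      (3 : ℤ) + 1 - Nat.card (⟨0, 0, 0, -1, b⟩ : WeierstrassCurve (ZMod 3)).toAffine.Point := by
    rw [WeierstrassCurve.NineGoodModel.specialFibreTrace, h]; norm_num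
  rw [e]
  exact ⟨GNineSpecialFibrePointCount.trace_specialFibre b, GNineSpecialFibrePointCount.three_dvd_trace_specialFibre b⟩

/-- Two integral models read in `K` through `ℚ` or directly agree. [folklore] -/
theorem map_map_intCast (V : WeierstrassCurve ℤ) :
    (V.map (Int.castRingHom ℚ)).map (algebraMap ℚ KNine) = V.map (Int.castRingHom KNine) := by
  rw [WeierstrassCurve.map_map]
  congr 1

/-! ### Leaf II: the change of variables over a field with `ζ₉`, and the power identity -/

/-- **The leaf-II change of variables lands on `⟨0, y₂θ⁻1, 0, y₄θ⁻2, y₆θ⁻2⟩`** (any field `F` with a primitive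
ninth root of unity `ζ`, `ϖ = 1 − ζ`, `u = ϖ²`, `r = gϖ²(1 + ϖ)`; the `yᵢ` and `θ⁻¹` as in the module docstring).
[cite: Tate1975, §7] -/
theorem leafII_smul_eq {F : Type*} [Field F] {ζ : F} (hζ : IsPrimitiveRoot ζ 9) (α₁ β γ₁ g : ℤ) (hg : g ^ 2 = 1) :
    (⟨Units.mk0 ((1 - ζ) ^ 2) (pow_ne_zero _ (GNine.one_sub_zeta_ne_zero hζ)), (g : F) * (1 - ζ) ^ 2 * (1 + (1 - ζ)), 0, 0⟩ : VariableChange F) •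
        ((⟨0, 3 * (3 * α₁ - g), 0, 9 * β, 3 * (3 * γ₁ + g)⟩ : WeierstrassCurve ℤ).map (Int.castRingHom F)) =
      ⟨0, (((-3 : ℤ) : F) * (1 - ζ) ^ 2 * (α₁ : F) + ((1 : ℤ) : F) * (1 - ζ) ^ 2 * (g : F) + ((-1 : ℤ) : F) * (1 - ζ) ^ 4 * (g : F) + ((-1 : ℤ) : F) * (1 - ζ) ^ 5 * (g : F)) * (-10 - 11 * ζ - 7 * ζ ^ 2 - 10 * ζ ^ 3 - 4 * ζ ^ 4 + 4 * ζ ^ 5) ^ 1, 0,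
        (((-6 : ℤ) : F) * (g : F) * (α₁ : F) + ((2 : ℤ) : F) * (g : F) ^ 2 + ((12 : ℤ) : F) * (1 - ζ) * (g : F) * (α₁ : F) + ((-4 : ℤ) : F) * (1 - ζ) * (g : F) ^ 2 + ((-1 : ℤ) : F) * (1 - ζ) ^ 2 + ((-18 : ℤ) : F) * (1 - ζ) ^ 2 * (g : F) * (α₁ : F) + ((6 : ℤ) : F) * (1 - ζ) ^ 2 * (g : F) ^ 2 + ((1 : ℤ) : F) * (1 - ζ) ^ 3 + ((6 : ℤ) : F) * (1 - ζ) ^ 3 * (g : F) * (α₁ : F) + ((-2 : ℤ) : F) * (1 - ζ) ^ 3 * (g : F) ^ 2 + ((-1 : ℤ) : F) * (1 - ζ) ^ 4 + ((1 : ℤ) : F) * (1 - ζ) ^ 4 * (β : F) + ((12 : ℤ) : F) * (1 - ζ) ^ 4 * (g : F) * (α₁ : F) + ((-4 : ℤ) : F) * (1 - ζ) ^ 4 * (g : F) ^ 2 + ((-2 : ℤ) : F) * (1 - ζ) ^ 5 + ((-18 : ℤ) : F) * (1 - ζ) ^ 5 * (g : F) * (α₁ : F) + ((6 : ℤ) :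 F) * (1 - ζ) ^ 5 * (g : F) ^ 2 + ((3 : ℤ) : F) * (1 - ζ) ^ 6 + ((12 : ℤ) : F) * (1 - ζ) ^ 6 * (g : F) * (α₁ : F) + ((-4 : ℤ) : F) * (1 - ζ) ^ 6 * (g : F) ^ 2 + ((-1 : ℤ) : F) * (1 - ζ) ^ 7 + ((-1 : ℤ) : F) * (1 - ζ) ^ 8 + ((2 : ℤ) : F) * (1 - ζ) ^ 9) * (-10 - 11 * ζ - 7 * ζ ^ 2 - 10 * ζ ^ 3 - 4 * ζ ^ 4 + 4 * ζ ^ 5) ^ 2,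
        (((1 : ℤ) : F) * (γ₁ : F) + ((3 : ℤ) : F) * (g : F) + ((-10 : ℤ) : F) * (1 - ζ) * (g : F) + ((19 : ℤ) : F) * (1 - ζ) ^ 2 * (g : F) + ((1 : ℤ) : F) * (1 - ζ) ^ 2 * (g : F) * (β : F) + ((-22 : ℤ) : F) * (1 - ζ) ^ 3 * (g : F) + ((1 : ℤ) : F) * (1 - ζ) ^ 3 * (g : F) * (β : F) + ((1 : ℤ) : F) * (1 - ζ) ^ 4 * (α₁ : F) + ((10 : ℤ) : F) * (1 - ζ) ^ 4 * (g : F) + ((2 : ℤ) : F) * (1 - ζ) ^ 5 * (α₁ : F) + ((3 : ℤ) : F) * (1 - ζ) ^ 5 * (g : F) + ((1 : ℤ) : F) * (1 - ζ) ^ 6 * (α₁ : F) + ((-8 : ℤ) : F) * (1 - ζ) ^ 6 * (g : F) + ((4 : ℤ) : F) * (1 - ζ) ^ 7 * (g : F)) * (-10 - 11 * ζ - 7 * ζ ^ 2 - 10 * ζ ^ 3 - 4 * ζ ^ 4 + 4 * ζ ^ 5) ^ 2⟩ := by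
  have hu0 : ((1 : F) - ζ) ^ 2 ≠ 0 := pow_ne_zero _ (GNine.one_sub_zeta_ne_zero hζ)
  have h6 := GNine.varpi_pow_six hζ
  have hθ := NineIntegers.theta_mul_thetaInv hζ
  have hgF : ((g : ℤ) : F) ^ 2 = 1 := by rw [← Int.cast_pow, hg, Int.cast_one]
  have key₂ := descend_coeff hθ hu0 (GNineSpecialFibre.leafII_a₂_identity ((1 : F) - ζ) α₁ g h6 hgF)
  have key₄ := descend_coeff hθ hu0 (GNineSpecialFibre.leafII_a₄_identity ((1 : F) - ζ) α₁ β g h6 hgF)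
  have key₆ := descend_coeff hθ hu0 (GNineSpecialFibre.leafII_a₆_identity ((1 : F) - ζ) α₁ β γ₁ g h6 hgF)
  have hCu : (↑(Units.mk0 ((1 - ζ) ^ 2) hu0)⁻¹ : F) = (((1 : F) - ζ) ^ 2)⁻¹ := by
    rw [Units.val_inv_eq_inv_val, Units.val_mk0]
  ext
  · simp only [variableChange_a₁, map_a₁, eq_intCast]
    push_cast
    ring
  · simp only [variableChange_a₂, map_a₁, map_a₂, eq_intCast, hCu]
    push_cast at key₂ ⊢
    linear_combination key₂
  · simp only [variableChange_a₃, map_a₁, map_a₃, eq_intCast]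
    push_cast
    ring
  · simp only [variableChange_a₄, map_a₁, map_a₂, map_a₃, map_a₄, eq_intCast, hCu]
    push_cast at key₄ ⊢
    linear_combination key₄
  · simp only [variableChange_a₆, map_a₁, map_a₂, map_a₃, map_a₄, map_a₆, eq_intCast, hCu]
    push_cast at key₆ ⊢
    linear_combination key₆

/-- **`u⁻¹² · 3^4 = θ⁻4`** for `u = (1 − ζ)^2` (`ϖ⁶ = −3θ`, `θθ⁻¹ = 1`): the discriminant of the leaf-II model is
`u⁻¹²·3^4·Δᵘ = θ⁻4·Δᵘ`. [folklore] -/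
theorem leafII_pow_identity {F : Type*} [Field F] {ζ : F} (hζ : IsPrimitiveRoot ζ 9) :
    (((1 : F) - ζ) ^ 2)⁻¹ ^ 12 * 81 = (-10 - 11 * ζ - 7 * ζ ^ 2 - 10 * ζ ^ 3 - 4 * ζ ^ 4 + 4 * ζ ^ 5) ^ 4 := by
  have hu0 : ((1 : F) - ζ) ^ 2 ≠ 0 := pow_ne_zero _ (GNine.one_sub_zeta_ne_zero hζ)
  have h6 := GNine.varpi_pow_six hζ
  have hθ := NineIntegers.theta_mul_thetaInv hζ
  have hui : (((1 : F) - ζ) ^ 2)⁻¹ * ((1 : F) - ζ) ^ 2 = 1 := inv_mul_cancel₀ hu0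
  linear_combination (-81 * (((1 : F) - ζ) ^ 2)⁻¹ ^ 12 * (1 + ((1 - 3 * (1 - ζ) + 6 * (1 - ζ) ^ 2 - 7 * (1 - ζ) ^ 3 + 5 * (1 - ζ) ^ 4 - 2 * (1 - ζ) ^ 5) * (-10 - 11 * ζ - 7 * ζ ^ 2 - 10 * ζ ^ 3 - 4 * ζ ^ 4 + 4 * ζ ^ 5)) ^ 1 + ((1 - 3 * (1 - ζ) + 6 * (1 - ζ) ^ 2 - 7 * (1 - ζ) ^ 3 + 5 * (1 - ζ) ^ 4 - 2 * (1 - ζ) ^ 5) * (-10 - 11 * ζ - 7 * ζ ^ 2 - 10 * ζ ^ 3 - 4 * ζ ^ 4 + 4 * ζ ^ 5)) ^ 2 + ((1 - 3 * (1 - ζ) + 6 * (1 - ζ) ^ 2 - 7 * (1 - ζ) ^ 3 + 5 * (1 - ζ) ^ 4 - 2 * (1 - ζ) ^ 5) * (-10 - 11 * ζ - 7 * ζ ^ 2 - 10 * ζ ^ 3 - 4 * ζ ^ 4 + 4 * ζ ^ 5)) ^ 3)) * hθ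
    + (-(((1 : F) - ζ) ^ 2)⁻¹ ^ 12 * (-10 - 11 * ζ - 7 * ζ ^ 2 - 10 * ζ ^ 3 - 4 * ζ ^ 4 + 4 * ζ ^ 5) ^ 4 * (((1 - ζ) ^ 6) ^ 3 * (-3 * (1 - 3 * (1 - ζ) + 6 * (1 - ζ) ^ 2 - 7 * (1 - ζ) ^ 3 + 5 * (1 - ζ) ^ 4 - 2 * (1 - ζ) ^ 5)) ^ 0 + ((1 - ζ) ^ 6) ^ 2 * (-3 * (1 - 3 * (1 - ζ) + 6 * (1 - ζ) ^ 2 - 7 * (1 - ζ) ^ 3 + 5 * (1 - ζ) ^ 4 - 2 * (1 - ζ) ^ 5)) ^ 1 + ((1 - ζ) ^ 6) ^ 1 * (-3 * (1 - 3 * (1 - ζ) + 6 * (1 - ζ) ^ 2 - 7 * (1 - ζ) ^ 3 + 5 * (1 - ζ) ^ 4 - 2 * (1 - ζ) ^ 5)) ^ 2 + ((1 - ζ) ^ 6) ^ 0 * (-3 * (1 - 3 * (1 - ζ) + 6 * (1 - ζ) ^ 2 - 7 * (1 - ζ) ^ 3 + 5 * (1 - ζ) ^ 4 - 2 * (1 -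 ζ) ^ 5)) ^ 3)) * h6
    + ((-10 - 11 * ζ - 7 * ζ ^ 2 - 10 * ζ ^ 3 - 4 * ζ ^ 4 + 4 * ζ ^ 5) ^ 4 * (1 + (((1 - ζ) ^ 2)⁻¹ * (1 - ζ) ^ 2) ^ 1 + (((1 - ζ) ^ 2)⁻¹ * (1 - ζ) ^ 2) ^ 2 + (((1 - ζ) ^ 2)⁻¹ * (1 - ζ) ^ 2) ^ 3 + (((1 - ζ) ^ 2)⁻¹ * (1 - ζ) ^ 2) ^ 4 + (((1 - ζ) ^ 2)⁻¹ * (1 - ζ) ^ 2) ^ 5 + (((1 - ζ) ^ 2)⁻¹ * (1 - ζ) ^ 2) ^ 6 + (((1 - ζ) ^ 2)⁻¹ * (1 - ζ) ^ 2) ^ 7 + (((1 - ζ) ^ 2)⁻¹ * (1 - ζ) ^ 2) ^ 8 + (((1 - ζ) ^ 2)⁻¹ * (1 - ζ) ^ 2) ^ 9 + (((1 - ζ) ^ 2)⁻¹ * (1 - ζ) ^ 2) ^ 10 + (((1 - ζ) ^ 2)⁻¹ * (1 - ζ) ^ 2) ^ 11)) * hui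

/-! ### Leaf II: the explicit good model over `𝓞` and its special fibre -/

/-- **Leaf II has an explicit good model over `𝓞 = integralClosure ℤ₃ ℚ₃(ζ₉)` with special fibre
`y² = x³ − x + γ̄₁` along EVERY reduction map.** For `V = ⟨0, 3 · (3 · α₁ - g), 0, 9 · β, 3 · (3 · γ₁ + g)⟩` (`g = ±1`): the change
`u = ϖ²`, `r = gϖ²(1 + ϖ)` produces the `NineGoodModel` `E = ⟨0, y₂θ⁻1, 0, y₄θ⁻2, y₆θ⁻2⟩` over `𝓞`
(`leafII_smul_eq` read in `K`), with `Δ(E) = θ⁻4·Δᵘ`, `3 ∤ Δᵘ` (a unit of `ℤ₃`), and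
`E mod (1 − ζ₉) = ⟨0, 0, 0, −1, γ̄₁⟩` for every `ρ : 𝓞 →+* 𝔽₃` (`ρ(1 − ζ₉) = 0`, `ρ(θ⁻¹) = 1`).
[cite: Tate1975, §7] [cite: Kraus1990, Théorème 1 (p = 3)] -/
theorem exists_nineGoodModel_leafII (α₁ β γ₁ g : ℤ) (hg : g ^ 2 = 1) :
    ∃ 𝓜 : (((⟨0, 3 * (3 * α₁ - g), 0, 9 * β, 3 * (3 * γ₁ + g)⟩ : WeierstrassCurve ℤ).map
        (Int.castRingHom ℚ))).NineGoodModel,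
      ∀ ρ : ONine →+* ZMod 3, 𝓜.specialFibre ρ = ⟨0, 0, 0, -1, (γ₁ : ZMod 3)⟩ := by
  set ζ := zeta 9 ℚ_[3] KNine with hζdef
  have hζ : IsPrimitiveRoot ζ 9 := NineIntegers.zeta_spec
  have hu0 : ((1 : KNine) - ζ) ^ 2 ≠ 0 := pow_ne_zero _ (GNine.one_sub_zeta_ne_zero hζ)
  have hθ := NineIntegers.theta_mul_thetaInv hζ
  have hval : ∀ x : ONine, algebraMap ONine KNine x = (x : KNine) := fun x => rfl
  -- the `𝓞`-side atoms: `ϖ = 1 − ζ₉` and `θ⁻¹`, opaque with their `K`-readings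
  obtain ⟨pO, hpO⟩ : ∃ x : ONine, x = ⟨1 - zeta 9 ℚ_[3] KNine, NineIntegers.one_sub_zeta_mem⟩ := ⟨_, rfl⟩
  obtain ⟨tiO, htiO⟩ : ∃ x : ONine, x = ⟨(-10 - 11 * zeta 9 ℚ_[3] KNine - 7 * zeta 9 ℚ_[3] KNine ^ 2 - 10 * zeta 9 ℚ_[3] KNine ^ 3 - 4 * zeta 9 ℚ_[3] KNine ^ 4 + 4 * zeta 9 ℚ_[3] KNine ^ 5), NineIntegers.thetaInv_mem⟩ := ⟨_, rfl⟩
  have hpOK : (pO : KNine) = 1 - ζ := by rw [hpO]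
  have htiOK : (tiO : KNine) = (-10 - 11 * ζ - 7 * ζ ^ 2 - 10 * ζ ^ 3 - 4 * ζ ^ 4 + 4 * ζ ^ 5) := by rw [htiO]
  -- the three coefficients of the model over `𝓞`, opaque, with their `K`-readings
  obtain ⟨a₂O, ha₂O⟩ : ∃ x : ONine, x = (((-3 : ℤ) : ONine) * pO ^ 2 * (α₁ : ONine) + ((1 : ℤ) : ONine) * pO ^ 2 * (g : ONine) + ((-1 : ℤ) : ONine) * pO ^ 4 * (g : ONine) + ((-1 : ℤ) : ONine) * pO ^ 5 * (g : ONine)) * tiO ^ 1 := ⟨_, rfl⟩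
  obtain ⟨a₄O, ha₄O⟩ : ∃ x : ONine, x = (((-6 : ℤ) : ONine) * (g : ONine) * (α₁ : ONine) + ((2 : ℤ) : ONine) * (g : ONine) ^ 2 + ((12 : ℤ) : ONine) * pO * (g : ONine) * (α₁ : ONine) + ((-4 : ℤ) : ONine) * pO * (g : ONine) ^ 2 + ((-1 : ℤ) : ONine) * pO ^ 2 + ((-18 : ℤ) : ONine) * pO ^ 2 * (g : ONine) * (α₁ : ONine) + ((6 : ℤ) : ONine) * pO ^ 2 * (g : ONine) ^ 2 + ((1 : ℤ) : ONine) * pO ^ 3 + ((6 : ℤ) : ONine) * pO ^ 3 * (g : ONine) * (α₁ : ONine) + ((-2 : ℤ) : ONine) * pO ^ 3 * (g : ONine) ^ 2 + ((-1 : ℤ) : ONine) * pO ^ 4 + ((1 : ℤ) : ONine) * pO ^ 4 * (β : ONine) + ((12 : ℤ) : ONine) * pO ^ 4 * (g : ONine) * (α₁ : ONine) + ((-4 : ℤ) : ONine) * pO ^ 4 * (g : ONine) ^ 2 + ((-2 : ℤ) : ONine) * pO ^ 5 + ((-18 : ℤ) : ONine) * pO ^ 5 * (g : ONine) * (α₁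 : ONine) + ((6 : ℤ) : ONine) * pO ^ 5 * (g : ONine) ^ 2 + ((3 : ℤ) : ONine) * pO ^ 6 + ((12 : ℤ) : ONine) * pO ^ 6 * (g : ONine) * (α₁ : ONine) + ((-4 : ℤ) : ONine) * pO ^ 6 * (g : ONine) ^ 2 + ((-1 : ℤ) : ONine) * pO ^ 7 + ((-1 : ℤ) : ONine) * pO ^ 8 + ((2 : ℤ) : ONine) * pO ^ 9) * tiO ^ 2 := ⟨_, rfl⟩
  obtain ⟨a₆O, ha₆O⟩ : ∃ x : ONine, x = (((1 : ℤ) : ONine) * (γ₁ : ONine) + ((3 : ℤ) : ONine) * (g : ONine) + ((-10 : ℤ) : ONine) * pO * (g : ONine) + ((19 : ℤ) : ONine) * pO ^ 2 * (g : ONine) + ((1 : ℤ) : ONine) * pO ^ 2 * (g : ONine) * (β : ONine) + ((-22 : ℤ) : ONine) * pO ^ 3 * (g : ONine) + ((1 : ℤ) : ONine) * pO ^ 3 * (g : ONine) * (β : ONine) + ((1 : ℤ) : ONine) * pO ^ 4 * (α₁ : ONine) + ((10 : ℤ) : ONine) * pO ^ 4 * (g : ONine) + ((2 : ℤ) : ONine)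 * pO ^ 5 * (α₁ : ONine) + ((3 : ℤ) : ONine) * pO ^ 5 * (g : ONine) + ((1 : ℤ) : ONine) * pO ^ 6 * (α₁ : ONine) + ((-8 : ℤ) : ONine) * pO ^ 6 * (g : ONine) + ((4 : ℤ) : ONine) * pO ^ 7 * (g : ONine)) * tiO ^ 2 := ⟨_, rfl⟩
  have c₂ : (a₂O : KNine) = (((-3 : ℤ) : KNine) * (1 - ζ) ^ 2 * (α₁ : KNine) + ((1 : ℤ) : KNine) * (1 - ζ) ^ 2 * (g : KNine) + ((-1 : ℤ) : KNine) * (1 - ζ) ^ 4 * (g : KNine) + ((-1 : ℤ) : KNine) * (1 - ζ) ^ 5 * (g : KNine)) * (-10 - 11 * ζ - 7 * ζ ^ 2 - 10 * ζ ^ 3 - 4 * ζ ^ 4 + 4 * ζ ^ 5) ^ 1 := by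
    rw [ha₂O]; push_cast; rw [hpOK, htiOK]
  have c₄ : (a₄O : KNine) = (((-6 : ℤ) : KNine) * (g : KNine) * (α₁ : KNine) + ((2 : ℤ) : KNine) * (g : KNine) ^ 2 + ((12 : ℤ) : KNine) * (1 - ζ) * (g : KNine) * (α₁ : KNine) + ((-4 : ℤ) : KNine) * (1 - ζ) * (g : KNine) ^ 2 + ((-1 : ℤ) : KNine) * (1 - ζ) ^ 2 + ((-18 : ℤ) : KNine) * (1 - ζ) ^ 2 * (g : KNine) * (α₁ : KNine) + ((6 : ℤ) : KNine) * (1 - ζ) ^ 2 * (g : KNine) ^ 2 + ((1 : ℤ) : KNine) * (1 - ζ) ^ 3 + ((6 : ℤ) : KNine) * (1 - ζ) ^ 3 * (g : KNine) * (α₁ : KNine) + ((-2 : ℤ) : KNine) * (1 - ζ) ^ 3 * (g : KNine) ^ 2 + ((-1 : ℤ) : KNine) * (1 - ζ) ^ 4 + ((1 : ℤ) : KNine) * (1 - ζ) ^ 4 * (β : KNine) + ((12 : ℤ) : KNine) * (1 - ζ) ^ 4 * (g : KNine) * (α₁ : KNine) + ((-4 : ℤ) : KNine) * (1 - ζ)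 ^ 4 * (g : KNine) ^ 2 + ((-2 : ℤ) : KNine) * (1 - ζ) ^ 5 + ((-18 : ℤ) : KNine) * (1 - ζ) ^ 5 * (g : KNine) * (α₁ : KNine) + ((6 : ℤ) : KNine) * (1 - ζ) ^ 5 * (g : KNine) ^ 2 + ((3 : ℤ) : KNine) * (1 - ζ) ^ 6 + ((12 : ℤ) : KNine) * (1 - ζ) ^ 6 * (g : KNine) * (α₁ : KNine) + ((-4 : ℤ) : KNine) * (1 - ζ) ^ 6 * (g : KNine) ^ 2 + ((-1 : ℤ) : KNine) * (1 - ζ) ^ 7 + ((-1 : ℤ) : KNine) * (1 - ζ) ^ 8 + ((2 : ℤ) : KNine) * (1 - ζ) ^ 9) * (-10 - 11 * ζ - 7 * ζ ^ 2 - 10 * ζ ^ 3 - 4 * ζ ^ 4 + 4 * ζ ^ 5) ^ 2 := by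
    rw [ha₄O]; push_cast; rw [hpOK, htiOK]
  have c₆ : (a₆O : KNine) = (((1 : ℤ) : KNine) * (γ₁ : KNine) + ((3 : ℤ) : KNine) * (g : KNine) + ((-10 : ℤ) : KNine) * (1 - ζ) * (g : KNine) + ((19 : ℤ) : KNine) * (1 - ζ) ^ 2 * (g : KNine) + ((1 : ℤ) : KNine) * (1 - ζ) ^ 2 * (g : KNine) * (β : KNine) + ((-22 : ℤ) : KNine) * (1 - ζ) ^ 3 * (g : KNine) + ((1 : ℤ) : KNine) * (1 - ζ) ^ 3 * (g : KNine) * (β : KNine) + ((1 : ℤ) : KNine) * (1 - ζ) ^ 4 * (α₁ : KNine) + ((10 : ℤ) : KNine) * (1 - ζ) ^ 4 * (g : KNine) + ((2 : ℤ) : KNine) * (1 - ζ) ^ 5 * (α₁ : KNine) + ((3 : ℤ) : KNine) * (1 - ζ) ^ 5 * (g : KNine) + ((1 : ℤ) : KNine) * (1 - ζ) ^ 6 * (α₁ : KNine) + ((-8 : ℤ) : KNine) * (1 - ζ) ^ 6 * (g : KNine) + ((4 : ℤ) : KNine) * (1 - ζ) ^ 7 * (g : KNine)) * (-10 - 11 *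 ζ - 7 * ζ ^ 2 - 10 * ζ ^ 3 - 4 * ζ ^ 4 + 4 * ζ ^ 5) ^ 2 := by
    rw [ha₆O]; push_cast; rw [hpOK, htiOK]
  -- the change of variables and the model
  have hsmul : (⟨Units.mk0 ((1 - ζ) ^ 2) (pow_ne_zero _ (GNine.one_sub_zeta_ne_zero hζ)), (g : KNine) * (1 - ζ) ^ 2 * (1 + (1 - ζ)), 0, 0⟩ :
        VariableChange KNine) • (((⟨0, 3 * (3 * α₁ - g), 0, 9 * β, 3 * (3 * γ₁ + g)⟩ : WeierstrassCurve ℤ).map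
          (Int.castRingHom ℚ)).map (algebraMap ℚ KNine)) =
      (⟨0, a₂O, 0, a₄O, a₆O⟩ : WeierstrassCurve ONine).map (algebraMap ONine KNine) := by
    rw [map_map_intCast, leafII_smul_eq hζ α₁ β γ₁ g hg]
    ext
    · rw [map_a₁, hval]; simp
    · rw [map_a₂, hval, c₂]
    · rw [map_a₃, hval]; simp
    · rw [map_a₄, hval, c₄]
    · rw [map_a₆, hval, c₆]
  -- the discriminant `Δ(E) = θ⁻4 · Δᵘ`, a unit of `𝓞`
  have hCu : (↑(Units.mk0 ((1 - ζ) ^ 2) (pow_ne_zero _ (GNine.one_sub_zeta_ne_zero hζ)))⁻¹ : KNine) =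
      (((1 : KNine) - ζ) ^ 2)⁻¹ := by
    rw [Units.val_inv_eq_inv_val, Units.val_mk0]
  have hpow := leafII_pow_identity hζ
  have hΔK : (((⟨0, a₂O, 0, a₄O, a₆O⟩ : WeierstrassCurve ONine).Δ : ONine) : KNine) = (-10 - 11 * ζ - 7 * ζ ^ 2 - 10 * ζ ^ 3 - 4 * ζ ^ 4 + 4 * ζ ^ 5) ^ 4 *
      (64 * (g : KNine) ^ 4 + 192 * (γ₁ : KNine) * (g : KNine) ^ 3 + 144 * (β : KNine) ^ 2 * (g : KNine) ^ 2 - 576 * (α₁ : KNine) * (g : KNine) ^ 3 - 1728 * (α₁ : KNine) * (γ₁ : KNine) * (g : KNine) ^ 2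
        - 864 * (α₁ : KNine) * (β : KNine) ^ 2 * (g : KNine) + 1728 * (α₁ : KNine) ^ 2 * (g : KNine) ^ 2 + 5184 * (α₁ : KNine) ^ 2 * (γ₁ : KNine) * (g : KNine) + 1296 * (α₁ : KNine) ^ 2 * (β : KNine) ^ 2
        - 1728 * (α₁ : KNine) ^ 3 * (g : KNine) - 5184 * (α₁ : KNine) ^ 3 * (γ₁ : KNine) - 288 * (β : KNine) * (g : KNine) ^ 2 - 864 * (β : KNine) * (γ₁ : KNine) * (g : KNine) - 576 * (β : KNine) ^ 3
        + 864 * (α₁ : KNine) * (β : KNine) * (g : KNine) + 2592 * (α₁ : KNine) * (β : KNine) * (γ₁ : KNine) - 48 * (g : KNine) ^ 2 - 288 * (γ₁ : KNine) * (g : KNine) - 432 * (γ₁ : KNine) ^ 2) := by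
    have e1 : (((⟨0, a₂O, 0, a₄O, a₆O⟩ : WeierstrassCurve ONine).Δ : ONine) : KNine) =
        ((⟨0, a₂O, 0, a₄O, a₆O⟩ : WeierstrassCurve ONine).map (algebraMap ONine KNine)).Δ := by
      rw [map_Δ]; rfl
    rw [e1, ← hsmul, variableChange_Δ, hCu, map_map_intCast, map_Δ, PSUntwistedTrace.leafII_Δ_eq α₁ β γ₁ g, eq_intCast]
    push_cast
    linear_combination (64 * (g : KNine) ^ 4 + 192 * (γ₁ : KNine) * (g : KNine) ^ 3 + 144 * (β : KNine) ^ 2 * (g : KNine) ^ 2 - 576 * (α₁ : KNine) * (g : KNine) ^ 3 - 1728 * (α₁ : KNine) * (γ₁ : KNine) * (g : KNine) ^ 2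
        - 864 * (α₁ : KNine) * (β : KNine) ^ 2 * (g : KNine) + 1728 * (α₁ : KNine) ^ 2 * (g : KNine) ^ 2 + 5184 * (α₁ : KNine) ^ 2 * (γ₁ : KNine) * (g : KNine) + 1296 * (α₁ : KNine) ^ 2 * (β : KNine) ^ 2
        - 1728 * (α₁ : KNine) ^ 3 * (g : KNine) - 5184 * (α₁ : KNine) ^ 3 * (γ₁ : KNine) - 288 * (β : KNine) * (g : KNine) ^ 2 - 864 * (β : KNine) * (γ₁ : KNine) * (g : KNine) - 576 * (β : KNine) ^ 3
        + 864 * (α₁ : KNine) * (β : KNine) * (g : KNine) + 2592 * (α₁ : KNine) * (β : KNine) * (γ₁ : KNine) - 48 * (g : KNine) ^ 2 - 288 * (γ₁ : KNine) * (g : KNine) - 432 * (γ₁ : KNine) ^ 2) * hpow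
  have hunit : IsUnit tiO := by
    refine IsUnit.of_mul_eq_one (⟨(1 - 3 * (1 - zeta 9 ℚ_[3] KNine) + 6 * (1 - zeta 9 ℚ_[3] KNine) ^ 2 - 7 * (1 - zeta 9 ℚ_[3] KNine) ^ 3 + 5 * (1 - zeta 9 ℚ_[3] KNine) ^ 4 - 2 * (1 - zeta 9 ℚ_[3] KNine) ^ 5), NineIntegers.theta_mem⟩ : ONine) (Subtype.ext ?_)
    push_cast
    rw [htiOK]
    linear_combination hθ
  have hΔu : IsUnit (((64 * g ^ 4 + 192 * γ₁ * g ^ 3 + 144 * β ^ 2 * g ^ 2 - 576 * α₁ * g ^ 3 - 1728 * α₁ * γ₁ * g ^ 2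
        - 864 * α₁ * β ^ 2 * g + 1728 * α₁ ^ 2 * g ^ 2 + 5184 * α₁ ^ 2 * γ₁ * g + 1296 * α₁ ^ 2 * β ^ 2
        - 1728 * α₁ ^ 3 * g - 5184 * α₁ ^ 3 * γ₁ - 288 * β * g ^ 2 - 864 * β * γ₁ * g - 576 * β ^ 3
        + 864 * α₁ * β * g + 2592 * α₁ * β * γ₁ - 48 * g ^ 2 - 288 * γ₁ * g - 432 * γ₁ ^ 2 : ℤ)) : ONine) := by
    have hnd := GNineFrobeniusTrace.leafII_not_three_dvd_Δu α₁ β γ₁ hg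
    have hn : ‖(((64 * g ^ 4 + 192 * γ₁ * g ^ 3 + 144 * β ^ 2 * g ^ 2 - 576 * α₁ * g ^ 3 - 1728 * α₁ * γ₁ * g ^ 2
        - 864 * α₁ * β ^ 2 * g + 1728 * α₁ ^ 2 * g ^ 2 + 5184 * α₁ ^ 2 * γ₁ * g + 1296 * α₁ ^ 2 * β ^ 2
        - 1728 * α₁ ^ 3 * g - 5184 * α₁ ^ 3 * γ₁ - 288 * β * g ^ 2 - 864 * β * γ₁ * g - 576 * β ^ 3
        + 864 * α₁ * β * g + 2592 * α₁ * β * γ₁ - 48 * g ^ 2 - 288 * γ₁ * g - 432 * γ₁ ^ 2 : ℤ)) : ℤ_[3])‖ = 1 := by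
      refine le_antisymm (PadicInt.norm_le_one _) (not_lt.mp fun hlt => hnd ?_)
      exact (PadicInt.norm_int_lt_one_iff_dvd _).mp hlt
    have hu := (PadicInt.isUnit_iff.mpr hn).map (algebraMap ℤ_[3] ONine)
    rwa [map_intCast] at hu
  have hΔ : IsUnit (⟨0, a₂O, 0, a₄O, a₆O⟩ : WeierstrassCurve ONine).Δ := by
    have e2 : (⟨0, a₂O, 0, a₄O, a₆O⟩ : WeierstrassCurve ONine).Δ = tiO ^ 4 * (((64 * g ^ 4 + 192 * γ₁ * g ^ 3 + 144 * β ^ 2 * g ^ 2 - 576 * α₁ * g ^ 3 - 1728 * α₁ * γ₁ * g ^ 2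
        - 864 * α₁ * β ^ 2 * g + 1728 * α₁ ^ 2 * g ^ 2 + 5184 * α₁ ^ 2 * γ₁ * g + 1296 * α₁ ^ 2 * β ^ 2
        - 1728 * α₁ ^ 3 * g - 5184 * α₁ ^ 3 * γ₁ - 288 * β * g ^ 2 - 864 * β * γ₁ * g - 576 * β ^ 3
        + 864 * α₁ * β * g + 2592 * α₁ * β * γ₁ - 48 * g ^ 2 - 288 * γ₁ * g - 432 * γ₁ ^ 2 : ℤ)) : ONine) :=
      Subtype.ext (by rw [hΔK]; push_cast; rw [htiOK])
    rw [e2]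
    exact (hunit.pow 4).mul hΔu
  -- the special fibre along any `ρ`: `ρ(ϖ) = 0`, `ρ(θ⁻¹) = 1`, integers mod `3`
  have h3 : (3 : ZMod 3) = 0 := by decide
  have hG2 : ((g : ℤ) : ZMod 3) ^ 2 = 1 := by exact_mod_cast congrArg (fun z : ℤ => (z : ZMod 3)) hg
  have hρp : ∀ ρ : ONine →+* ZMod 3, ρ pO = 0 := fun ρ => by
    rw [hpO]; exact NineIntegers.residueMap_one_sub_zeta ρ
  have hρt : ∀ ρ : ONine →+* ZMod 3, ρ tiO = 1 := fun ρ => by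
    rw [htiO]; exact NineIntegers.residueMap_thetaInv ρ
  have r₂ : ∀ ρ : ONine →+* ZMod 3, ρ a₂O = 0 := fun ρ => by
    rw [ha₂O]
    simp only [map_mul, map_pow, map_add, map_sub, map_neg, map_intCast, map_one, hρp ρ, hρt ρ]
    ring
  have r₄ : ∀ ρ : ONine →+* ZMod 3, ρ a₄O = -1 := fun ρ => by
    rw [ha₄O]
    simp only [map_mul, map_pow, map_add, map_sub, map_neg, map_intCast, map_one, hρp ρ, hρt ρ]
    linear_combination (2 : ZMod 3) * hG2 + (-2 * ((g : ℤ) : ZMod 3) * ((α₁ : ℤ) : ZMod 3) + 1) * h3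
  have r₆ : ∀ ρ : ONine →+* ZMod 3, ρ a₆O = (γ₁ : ZMod 3) := fun ρ => by
    rw [ha₆O]
    simp only [map_mul, map_pow, map_add, map_sub, map_neg, map_intCast, map_one, hρp ρ, hρt ρ]
    linear_combination (((g : ℤ) : ZMod 3)) * h3
  refine ⟨⟨⟨0, a₂O, 0, a₄O, a₆O⟩, _, hΔ, hsmul⟩, fun ρ => ?_⟩
  simp only [WeierstrassCurve.NineGoodModel.specialFibre]
  ext
  · rw [map_a₁, map_zero]
  · rw [map_a₂]; exact r₂ ρ
  · rw [map_a₃, map_zero]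
  · rw [map_a₄]; exact r₄ ρ
  · rw [map_a₆]; exact r₆ ρ

/-- **Leaf II: `3 ∣ specialFibreTrace = psUntwistedTrace` on an explicit good model, for every reduction map** —
the two data the named fact `isDescendedFrobeniusMatrix_exists` / `IsDescendedFrobeniusMatrix.trace_eq` consume on this
family (`a_w(V) = −3·valMinAbs γ̄₁`; cycu-p3's `psUntwistedTrace_leafII_eq_trace`).
[cite: Kraus1990, Théorème 1 (p = 3)] [cite: Tate1975, §7] -/
theorem exists_nineGoodModel_trace_leafII (α₁ β γ₁ g : ℤ) (hg : g ^ 2 = 1) :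
    ∃ 𝓜 : (((⟨0, 3 * (3 * α₁ - g), 0, 9 * β, 3 * (3 * γ₁ + g)⟩ : WeierstrassCurve ℤ).map
        (Int.castRingHom ℚ))).NineGoodModel,
      ∀ ρ : ONine →+* ZMod 3, (3 : ℤ) ∣ 𝓜.specialFibreTrace ρ ∧
        𝓜.specialFibreTrace ρ =
          (((⟨0, 3 * (3 * α₁ - g), 0, 9 * β, 3 * (3 * γ₁ + g)⟩ : WeierstrassCurve ℤ).map
            (Int.castRingHom ℚ))).psUntwistedTrace := by
  obtain ⟨𝓜, h𝓜⟩ := exists_nineGoodModel_leafII α₁ β γ₁ g hg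
  refine ⟨𝓜, fun ρ => ?_⟩
  obtain ⟨-, hdvd, -⟩ := specialFibreTrace_eq_of_specialFibre_eq 𝓜 ρ _ (h𝓜 ρ)
  refine ⟨hdvd, ?_⟩
  rw [PSUntwistedTrace.psUntwistedTrace_leafII_eq_trace α₁ β γ₁ hg, WeierstrassCurve.NineGoodModel.specialFibreTrace, h𝓜 ρ]
  norm_num

end Summit.BirchSwinnertonDyer.BirchSwinnertonDyer.Theorems.NineGoodModels

end
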